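import Mathlib
import Summits.NavierStokesRegularity.NavierStokesRegularity.Theorems.WakeRatchetTailTools
import Summits.NavierStokesRegularity.NavierStokesRegularity.Theorems.WakeRatchetTailEnvelopeFinite
import HarnessLib

/-!
# Route `WakeRatchet` — BLOCK STARVATION: the `a = 1` bookkeeping survives the BLOCK repair of the rate cruxes
# (helper for ⟨stmt-NavierStokesRegularity-25646⟩ `EternalInviscidRate`; repair census in kernel form)

The landed support `RatchetStarvation` (p-landed `WakeRatchetRatchetStarvation.lean`) turns the PER-SHELL tail contraction
`Θ_{n+1} ≤ (1−w)Θ_n` with `(1+ε₀)(1−w) < 1` into `¬ EternalSurvivingFwd 1`.  Instrument E-g10-2/E-g10-3 (evidence RESULT-E-g10-2.md,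
RESULT-E-g10-3.md on ⟨25646⟩; certified table `tao2rot ∈ E₂(4)`) reads OBSERVATION O-2: the per-shell envelope rate of cascading fronts
FLUCTUATES and dips below `1` at a positive fraction of shells, while the rate over BLOCKS of `b ≳ 1/(4ε₀)` shells stays `> 1` — i.e. the
per-shell rate cruxes `EternalInviscidRate` ⟨25646⟩ / `EternalViscousRate` ⟨25647⟩ / `TailRateRatchet` ⟨25584⟩ are suspected MISSTATED
per shell, with BLOCK forms as the repair (planner ns-idea-1 g10/g11: `block_starvation_sketch.lean` 252d9be9, LINE g11-2 «block ledger»,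
evidence on ⟨25646⟩; not filed as items).  This file lands, DEF-FREE, the fact the repair decision needs: the route's `a = 1` obligation
is insensitive to the block length.

* `tail_succ_le`, `tail_add_le` — tails nest in the shell index (`Θ_{n+i}(σ) ≤ Θ_n(σ)`, from `UniformBound`).
* `tail_le_pow_block` — block induction: contraction by `1 − w` over blocks of `b` shells gives `Θ_{jb}(σ) ≤ r^j Θ₀`, `r = max(1−w) 0`.
* `main` — **BLOCK STARVATION**: finite tail envelopes and the block contraction with `(1+ε₀)^b (1−w) < 1` exclude forward
  `(S₁)`-survival (the weighted energies `(1+ε₀)^n E_n ≤ (1+ε₀)^b · Q^{⌊n/b⌋} Θ₀`, `Q = (1+ε₀)^b r < 1`).  `b = 1` is the landed item.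
* `not_survivingFwd_of_blockRate` — the RATE form: a contraction by `(1+ε₀)^{−ab}` over blocks of `b ≥ 1` shells with `a > 1` starves
  every uniformly bounded admissible eternal solution of a cancelling table (tail envelopes from the landed `TailEnvelopeFinite`).
* `noSurvivingEternalViscBdd_of_blockRateRatchet` — hence a BLOCK RATE RATCHET at spread `R` (the block form of `TailRateRatchet`, written
  out: `∃ a > 1, ∃ εs, ∀ ε₀ ≤ εs, ∃ b ≥ 1, …, Θ_{n+b} ≤ (1+ε₀)^{−ab}·M`) gives the K1ᵛ Liouville predicate `NoSurvivingEternalViscBdd R 1`,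
  and with the extraction crux `EternalRigidityViscBdd R 1` the rung-leaf predicate `NoRobustBlowupBelow R` (`noRobustBlowupBelow_of_blockRateRatchet`)
  — exactly what `WakeRatchet.closes` derives from the per-shell ratchet.
Adapted from the planner's kernel-checked sketch `block_starvation_sketch.lean` (sha16 252d9be9, planner-ns-idea-1-g10, evidence on ⟨25646⟩),
restated without its `def`s.  HONEST LABEL: bookkeeping on bounded eternal solutions of Tao-type MODEL lattice ODEs; no registered stub of any
skeleton is closed; the block statements are NOT route items; nothing here is a statement about the Navier–Stokes equations and the rung leaf
`TaoLadderRungTwoBreak.Target` is not the summit.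
[cite: Tao2016AveragedNS, §4 Thm. 4.2 (statement shape), Lemma 4.1 (4.8)–(4.10), §6.4; elementary]
-/

noncomputable section

set_option linter.dupNamespace false

namespace Summit.NavierStokesRegularity.NavierStokesRegularity.Theorems

namespace RatchetStarvationBlock

open Filter Topology
open Literature.Analysis.FluidPDE Literature.Analysis.FluidPDE.TaoCascade
open WakeRatchetTail

variable {m : ℕ} {ε₀ : ℝ} {W : ℤ → ℝ → Em m}

/-- Tails nest in the shell index: `Θ_{n+1}(σ) ≤ Θ_n(σ)` (uniformly bounded family, `ε₀ > 0`).
[cite: Tao2016AveragedNS, §4 Lemma 4.1 (4.10) (local energies), §6.4; elementary] -/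
theorem tail_succ_le (hε : 0 < ε₀) (hU : UniformBound W) (n : ℤ) (σ : ℝ) :
    ∑' k : ℕ, physEnergy ε₀ W (n + 1 + k) σ ≤ ∑' k : ℕ, physEnergy ε₀ W (n + k) σ := by
  have hs := summable_tail hε hU n σ
  rw [hs.tsum_eq_zero_add]
  have e : ∑' k : ℕ, physEnergy ε₀ W (n + ((k + 1 : ℕ) : ℤ)) σ = ∑' k : ℕ, physEnergy ε₀ W (n + 1 + k) σ :=
    tsum_congr fun k => by push_cast; ring_nf
  rw [e]
  have h0 : 0 ≤ physEnergy ε₀ W (n + ((0 : ℕ) : ℤ)) σ := physEnergy_nonneg _ _ _ _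
  linarith

/-- `Θ_{n+i}(σ) ≤ Θ_n(σ)` for every `i : ℕ`.
[cite: Tao2016AveragedNS, §4 Lemma 4.1 (4.10), §6.4; elementary] -/
theorem tail_add_le (hε : 0 < ε₀) (hU : UniformBound W) (n : ℤ) (σ : ℝ) :
    ∀ i : ℕ, ∑' k : ℕ, physEnergy ε₀ W (n + i + k) σ ≤ ∑' k : ℕ, physEnergy ε₀ W (n + k) σ := by
  intro i
  induction i with
  | zero => simp
  | succ i ih =>
    have h := tail_succ_le hε hU (n + i) σ
    have e : n + ((i + 1 : ℕ) : ℤ) = n + i + 1 := by push_cast; ring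
    rw [e]
    exact h.trans ih

/-- Block contraction induction: `Θ_{jb}(σ) ≤ r^j Θ₀` with `r = max (1 − w) 0`.
[cite: Tao2016AveragedNS, §4 (statement shape only); elementary induction] -/
theorem tail_le_pow_block {w Θ₀ : ℝ} {b : ℕ} (hΘ₀ : 0 ≤ Θ₀)
    (hΘ : ∀ σ : ℝ, ∑' k : ℕ, physEnergy ε₀ W ((0 : ℤ) + k) σ ≤ Θ₀)
    (hContr : ∀ (n : ℤ) (M : ℝ), (∀ σ : ℝ, ∑' k : ℕ, physEnergy ε₀ W (n + k) σ ≤ M) →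
      ∀ σ : ℝ, ∑' k : ℕ, physEnergy ε₀ W (n + b + k) σ ≤ (1 - w) * M) :
    ∀ (j : ℕ) (σ : ℝ), ∑' k : ℕ, physEnergy ε₀ W (((j * b : ℕ) : ℤ) + k) σ ≤ max (1 - w) 0 ^ j * Θ₀ := by
  intro j
  induction j with
  | zero =>
    intro σ
    simpa only [Nat.zero_mul, Nat.cast_zero, pow_zero, one_mul] using hΘ σ
  | succ j ih =>
    intro σ
    have h := hContr ((j * b : ℕ) : ℤ) (max (1 - w) 0 ^ j * Θ₀) ih σ
    have hnn : 0 ≤ max (1 - w) 0 ^ j * Θ₀ := mul_nonneg (pow_nonneg (le_max_right _ _) _) hΘ₀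
    have e : (((j + 1) * b : ℕ) : ℤ) = ((j * b : ℕ) : ℤ) + b := by push_cast; ring
    rw [e]
    calc ∑' k : ℕ, physEnergy ε₀ W (((j * b : ℕ) : ℤ) + b + k) σ
        ≤ (1 - w) * (max (1 - w) 0 ^ j * Θ₀) := h
      _ ≤ max (1 - w) 0 * (max (1 - w) 0 ^ j * Θ₀) :=
          mul_le_mul_of_nonneg_right (le_max_left _ _) hnn
      _ = max (1 - w) 0 ^ (j + 1) * Θ₀ := by ring

/-- **BLOCK STARVATION.**  Finite tail envelopes and the tail contraction by `1 − w` over blocks of `b ≥ 1` shells with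
`(1+ε₀)^b (1 − w) < 1` force the `a = 1`-weighted shell energies to decay geometrically along the shells, uniformly in `σ` —
incompatible with forward `(S₁)`-survival.  (`b = 1` is the landed `RatchetStarvation.main`.)
[cite: Tao2016AveragedNS, §4 Thm. 4.2 (statement shape), Lemma 4.1 (4.8)–(4.10), §6.4; elementary] -/
theorem main {w : ℝ} {b : ℕ} (hε : 0 < ε₀) (hb : 1 ≤ b)
    (hq : (1 + ε₀) ^ b * (1 - w) < 1) (hU : UniformBound W)
    (hEnv : ∀ n : ℤ, ∃ M : ℝ, ∀ σ : ℝ, ∑' k : ℕ, physEnergy ε₀ W (n + k) σ ≤ M)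
    (hContr : ∀ (n : ℤ) (M : ℝ), (∀ σ : ℝ, ∑' k : ℕ, physEnergy ε₀ W (n + k) σ ≤ M) →
      ∀ σ : ℝ, ∑' k : ℕ, physEnergy ε₀ W (n + b + k) σ ≤ (1 - w) * M) :
    ¬ EternalSurvivingFwd 1 ε₀ W := by
  obtain ⟨Θ₀, hΘ⟩ := hEnv 0
  have hΘ₀ : 0 ≤ Θ₀ :=
    (tsum_nonneg fun k : ℕ => physEnergy_nonneg ε₀ W ((0 : ℤ) + (k : ℤ)) 0).trans (hΘ 0)
  have h1ε : 0 ≤ 1 + ε₀ := by linarith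
  have h1ε' : 1 ≤ 1 + ε₀ := by linarith
  set r : ℝ := max (1 - w) 0 with hr
  have hr0 : 0 ≤ r := le_max_right _ _
  set Q : ℝ := (1 + ε₀) ^ b * r with hQdef
  have hQ0 : 0 ≤ Q := mul_nonneg (pow_nonneg h1ε b) hr0
  have hQ1 : Q < 1 := by
    rcases le_or_gt 0 (1 - w) with h | h
    · have : r = 1 - w := max_eq_left h
      rw [hQdef, this]; exact hq
    · have : r = 0 := max_eq_right h.le
      rw [hQdef, this, mul_zero]; exact one_pos
  -- tails at every shell: Θ_n ≤ r^{n / b} Θ₀ (block induction + nesting in the shell index)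
  have htail : ∀ (n : ℕ) (σ : ℝ), ∑' k : ℕ, physEnergy ε₀ W ((n : ℤ) + k) σ ≤ r ^ (n / b) * Θ₀ := by
    intro n σ
    have hdecomp : (n : ℤ) = (((n / b) * b : ℕ) : ℤ) + ((n % b : ℕ) : ℤ) := by
      have h := Nat.div_add_mod' n b
      exact_mod_cast h.symm
    rw [hdecomp]
    exact (tail_add_le hε hU _ σ (n % b)).trans (tail_le_pow_block hΘ₀ hΘ hContr (n / b) σ)
  -- weighted energies: p_n ≤ (1+ε₀)^b · Q^{n / b} · Θ₀
  have hwt : ∀ (n : ℕ) (σ : ℝ), wtEnergy ε₀ W n σ ≤ (1 + ε₀) ^ b * (Q ^ (n / b) * Θ₀) := by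
    intro n σ
    rw [wtEnergy_eq hε]
    have h1 : physEnergy ε₀ W n σ ≤ r ^ (n / b) * Θ₀ :=
      (physEnergy_le_tail hε hU n σ).trans (htail n σ)
    have h2 : (0 : ℝ) ≤ (1 + ε₀) ^ n := pow_nonneg h1ε n
    have hpow : (1 + ε₀) ^ n ≤ (1 + ε₀) ^ b * (1 + ε₀) ^ ((n / b) * b) := by
      rw [← pow_add]
      refine pow_le_pow_right₀ h1ε' ?_
      have h3 := Nat.div_add_mod' n b
      have h4 : n % b < b := Nat.mod_lt n (by omega)
      omega
    have hrn : 0 ≤ r ^ (n / b) * Θ₀ := mul_nonneg (pow_nonneg hr0 _) hΘ₀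
    calc (1 + ε₀) ^ n * physEnergy ε₀ W n σ
        ≤ (1 + ε₀) ^ n * (r ^ (n / b) * Θ₀) := mul_le_mul_of_nonneg_left h1 h2
      _ ≤ ((1 + ε₀) ^ b * (1 + ε₀) ^ ((n / b) * b)) * (r ^ (n / b) * Θ₀) :=
          mul_le_mul_of_nonneg_right hpow hrn
      _ = (1 + ε₀) ^ b * (Q ^ (n / b) * Θ₀) := by
          rw [hQdef, mul_pow, ← pow_mul, mul_comm (n / b) b]; ring
  -- survival would pin a fixed positive level at arbitrarily high shells
  rintro ⟨c, hc, hsurv⟩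
  have hlim : Tendsto (fun j : ℕ => (1 + ε₀) ^ b * (Q ^ j * Θ₀)) atTop (𝓝 0) := by
    have := ((tendsto_pow_atTop_nhds_zero_of_lt_one hQ0 hQ1).mul_const Θ₀).const_mul ((1 + ε₀) ^ b)
    simpa only [zero_mul, mul_zero] using this
  obtain ⟨J, hJ⟩ := eventually_atTop.1 (hlim.eventually (gt_mem_nhds hc))
  obtain ⟨n, hn, σ, -, hle⟩ := hsurv (J * b)
  have hJn : J ≤ n / b := (Nat.le_div_iff_mul_le (by omega)).2 hn
  have h1 : c ≤ wtEnergy ε₀ W n σ := hle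
  have h2 : (1 + ε₀) ^ b * (Q ^ (n / b) * Θ₀) < c := hJ (n / b) hJn
  linarith [hwt n σ]

/-- **RATE FORM.**  A tail contraction by `(1+ε₀)^{−ab}` over blocks of `b ≥ 1` shells with `a > 1` starves every uniformly bounded
admissible eternal solution (covariant viscosity `ν̂`, cancelling table): `(1+ε₀)^b (1+ε₀)^{−ab} = (1+ε₀)^{b(1−a)} < 1`; the finite tail
envelopes come from the landed `TailEnvelopeFinite.main`.
[cite: Tao2016AveragedNS, §4 Thm. 4.2 (statement shape), Lemma 4.1 (4.8)–(4.10), §6.4; elementary] -/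
theorem not_survivingFwd_of_blockRate {νh : ℝ} {α : Fin 4 → Fin 4 → Fin 4 → ℤ × ℤ × ℤ → ℝ} {W : ℤ → ℝ → Em 4}
    (hε : 0 < ε₀) (hc : IsCancellingCoeff α) (hW : IsEternalVisc ε₀ νh α W) (hU : UniformBound W)
    {a : ℝ} (ha : 1 < a) {b : ℕ} (hb : 1 ≤ b)
    (hContr : ∀ (n : ℤ) (M : ℝ), (∀ σ : ℝ, ∑' k : ℕ, physEnergy ε₀ W (n + k) σ ≤ M) →
      ∀ σ : ℝ, ∑' k : ℕ, physEnergy ε₀ W (n + b + k) σ ≤ (1 + ε₀) ^ (-(a * b)) * M) :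
    ¬ EternalSurvivingFwd 1 ε₀ W := by
  have hbR : (1 : ℝ) ≤ b := by exact_mod_cast hb
  have hb1 : 1 < 1 + ε₀ := by linarith
  have hb0 : (0 : ℝ) < 1 + ε₀ := by linarith
  -- w := 1 − (1+ε₀)^{−ab};  (1+ε₀)^b (1 − w) = (1+ε₀)^{b − ab} < 1
  have hprod : (1 + ε₀) ^ b * (1 - (1 - (1 + ε₀) ^ (-(a * b)))) < 1 := by
    rw [sub_sub_cancel, ← Real.rpow_natCast (1 + ε₀) b, ← Real.rpow_add hb0]
    refine Real.rpow_lt_one_of_one_lt_of_neg hb1 ?_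
    nlinarith
  refine main hε hb hprod hU (TailEnvelopeFinite.main hε hc hW hU) ?_
  intro n M hM σ
  have h1 := hContr n M hM σ
  rwa [sub_sub_cancel]

/-- **The BLOCK RATE RATCHET at spread `R` gives the K1ᵛ Liouville predicate `NoSurvivingEternalViscBdd R 1`.**  Hypothesis (the block
form of `WakeRatchet.TailRateRatchet` at spread `R`, written out; NOT a route item): some `a > 1` and `εs > 0` such that for all
`0 < ε₀ ≤ εs` there is a block length `b ≥ 1` with: every table of `E₂(R)`, every uniformly bounded admissible eternal solution
(any covariant viscosity `ν̂`), every shell `n`: a bound `M` on the tail above `n` at all log-times bounds the tail above `n + b` by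
`(1+ε₀)^{−ab}·M` at all log-times.  MODEL lattice only.
[cite: Tao2016AveragedNS, §4 Thm. 4.2 (statement shape), Lemma 4.1 (4.8)–(4.10), §6.4; elementary] -/
theorem noSurvivingEternalViscBdd_of_blockRateRatchet {R : ℝ}
    (h : ∃ a : ℝ, 1 < a ∧ ∃ εs : ℝ, 0 < εs ∧ ∀ ε₀ : ℝ, 0 < ε₀ → ε₀ ≤ εs →
      ∃ b : ℕ, 1 ≤ b ∧
      ∀ α : Fin 4 → Fin 4 → Fin 4 → ℤ × ℤ × ℤ → ℝ, InTableClass R α →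
      ∀ (νh : ℝ) (W : ℤ → ℝ → Em 4), IsEternalVisc ε₀ νh α W → UniformBound W →
      ∀ (n : ℤ) (M : ℝ), (∀ σ : ℝ, ∑' k : ℕ, physEnergy ε₀ W (n + k) σ ≤ M) →
        ∀ σ : ℝ, ∑' k : ℕ, physEnergy ε₀ W (n + b + k) σ ≤ (1 + ε₀) ^ (-(a * b)) * M) :
    NoSurvivingEternalViscBdd R 1 := by
  obtain ⟨a, ha, εs, hεs, H⟩ := h
  refine ⟨εs, hεs, ?_⟩
  intro ε₀ hε₀ hle α hα νh W hW hU
  obtain ⟨b, hb, Hb⟩ := H ε₀ hε₀ hle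
  exact not_survivingFwd_of_blockRate hε₀ hα.2.1 hW hU ha hb (fun n M hM σ => Hb α hα νh W hW hU n M hM σ)

/-- **The repaired deciding chain still reaches the rung-leaf predicate.**  The block rate ratchet at spread `R` (written out, as above)
together with the extraction crux `EternalRigidityViscBdd R 1` (route item K2ᵛ(1)) gives `NoRobustBlowupBelow R`, by the tree glue
`noRobustBlowupBelow_of_eternalViscBdd` — the same two steps as `WakeRatchet.closes`, with the per-shell ratchet replaced by the block one.
MODEL lattice only; both hypotheses are NOT supplied by the tree; nothing about NS, and `NoRobustBlowupBelow` is a MODEL-rung predicate.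
[cite: Tao2016AveragedNS, §4 Thm. 4.2 (statement shape), §6.4; elementary] -/
theorem noRobustBlowupBelow_of_blockRateRatchet {R : ℝ}
    (h : ∃ a : ℝ, 1 < a ∧ ∃ εs : ℝ, 0 < εs ∧ ∀ ε₀ : ℝ, 0 < ε₀ → ε₀ ≤ εs →
      ∃ b : ℕ, 1 ≤ b ∧
      ∀ α : Fin 4 → Fin 4 → Fin 4 → ℤ × ℤ × ℤ → ℝ, InTableClass R α →
      ∀ (νh : ℝ) (W : ℤ → ℝ → Em 4), IsEternalVisc ε₀ νh α W → UniformBound W →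
      ∀ (n : ℤ) (M : ℝ), (∀ σ : ℝ, ∑' k : ℕ, physEnergy ε₀ W (n + k) σ ≤ M) →
        ∀ σ : ℝ, ∑' k : ℕ, physEnergy ε₀ W (n + b + k) σ ≤ (1 + ε₀) ^ (-(a * b)) * M)
    (hK2 : EternalRigidityViscBdd R 1) :
    NoRobustBlowupBelow R :=
  noRobustBlowupBelow_of_eternalViscBdd (noSurvivingEternalViscBdd_of_blockRateRatchet h) hK2

end RatchetStarvationBlock

end Summit.NavierStokesRegularity.NavierStokesRegularity.Theorems

end
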